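import Summits.Ventures.DiscreteObjects.Hadamard.CompositeOrderStructure668C
import Summits.Ventures.DiscreteObjects.Hadamard.CompositeOrderCRT668

/-!
# Hadamard 668 census, family F12 — orders 69 and 55 sharpened by the two-moduli fixed-row sums
# (kernel, structure: 4 resp. 7 admissible fixed-point triples)

Framing: lottery ticket; floor = certified bounds/negative ranges.

Cell pub-namedobj (venture DiscreteObjects), target (H), hadamard gen 18.  `CompositeOrderStructure668C` left six
triples `(f₃, f₂₃, f')` for an element of order `69` and eight triples `(f₅, f₁₁, f')` for order `55` (counting +
censuses + free-orbit bound).  The two-moduli sums of `CompositeOrderCRT668` (`composite_pair_dvd`) for a pair of rows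
fixed by both parts remove three of them:
* order 69, `(26, 24, 3)` and `(32, 24, 9)`: with `A` = sum over the common columns (odd, `|A| ≤ 3` resp. `≤ 9`), `X` =
  sum over `Fix κ³ ∖ common` (`21` resp. `15` columns, `3 ∣ X`), `Y` = sum over `Fix κ²³ ∖ common` (`23` columns,
  `23 ∣ Y`, odd ⇒ `Y = ±23`): `23 ∣ A + X` with `|A + X| ≤ 24` even forces `A = −X ∈ 3ℤ`, then `3 ∣ A + Y` forces
  `3 ∣ 23` — false (`order69_arith26/32`);
* order 55, `(58, 8, 3)`: `X` = sum over the `5` columns of `Fix κ⁵ ∖ common` is `±5`, and `11 ∣ A + X` with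
  `|A + X| ≤ 8` forces `A = ∓5`, impossible for `|A| ≤ 3` (`order55_arith58`).
The rows fall in the same case as the columns because the prime-order parts fix as many rows as columns
(`signedAut_card_fixed_eq`, gen 18), so two rows fixed by both parts exist whenever the column case has `f' ≥ 2`.
RESULTS: **`hadamard668_order69_structure'`** — `(f₃, f₂₃, f') ∈ {(92,24,0), (98,24,6), (116,1,1), (164,24,3)}`;
**`hadamard668_order55_structure'`** — `(f₅, f₁₁, f') ∈ {(8,8,8), (18,52,7), (38,30,5), (68,52,2), (78,52,12), (88,30,0),
(98,30,10)}` (columns and rows).  STRUCTURE only; neither order is excluded.  Ours; no `sorry`, no definitions.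
-/

namespace Summit.Ventures.DiscreteObjects.Hadamard

open Finset BigOperators Matrix

open Literature.Combinatorics.Designs.GoethalsSeidel (IsHadamardMatrix)

variable {ι : Type*} [Fintype ι] [DecidableEq ι]

/-! ### the three integer systems (staged `omega`) -/

/-- the integer system of order 69, case `(26, 24, 3)`, is infeasible (staged `omega`) -/
lemma order69_arith26 (a b c : ℕ) (k₁ k₂ k₃ k₄ : ℤ) (ha : a ≤ 3) (hb : b ≤ 21) (hc : c ≤ 23)
    (hk₁ : (3:ℤ) - 2 * (a:ℤ) + ((21:ℤ) - 2 * (b:ℤ)) = 23 * k₁)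
    (hk₂ : (3:ℤ) - 2 * (a:ℤ) + ((23:ℤ) - 2 * (c:ℤ)) = 3 * k₂)
    (hk₃ : (21:ℤ) - 2 * (b:ℤ) = 3 * k₃) (hk₄ : (23:ℤ) - 2 * (c:ℤ) = 23 * k₄) : False := by
  have h4 : c = 0 ∨ c = 23 := by clear hk₁ hk₂ hk₃ ha hb; omega
  have h1 : a + b = 12 := by clear hk₂ hk₃ hk₄ hc h4; omega
  have h3 : b = 9 ∨ b = 12 := by clear hk₂ hk₄ hc h4; omega
  clear hk₁ hk₃ hk₄
  rcases h4 with rfl | rfl <;> rcases h3 with rfl | rfl <;> omega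

/-- the integer system of order 69, case `(32, 24, 9)`, is infeasible (staged `omega`) -/
lemma order69_arith32 (a b c : ℕ) (k₁ k₂ k₃ k₄ : ℤ) (ha : a ≤ 9) (hb : b ≤ 15) (hc : c ≤ 23)
    (hk₁ : (9:ℤ) - 2 * (a:ℤ) + ((15:ℤ) - 2 * (b:ℤ)) = 23 * k₁)
    (hk₂ : (9:ℤ) - 2 * (a:ℤ) + ((23:ℤ) - 2 * (c:ℤ)) = 3 * k₂)
    (hk₃ : (15:ℤ) - 2 * (b:ℤ) = 3 * k₃) (hk₄ : (23:ℤ) - 2 * (c:ℤ) = 23 * k₄) : False := by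
  have h4 : c = 0 ∨ c = 23 := by clear hk₁ hk₂ hk₃ ha hb; omega
  have h1 : a + b = 12 := by clear hk₂ hk₃ hk₄ hc h4; omega
  have h3 : b = 3 ∨ b = 6 ∨ b = 9 ∨ b = 12 ∨ b = 15 ∨ b = 0 := by clear hk₁ hk₂ hk₄ hc h4 h1; omega
  clear hk₁ hk₃ hk₄
  rcases h4 with rfl | rfl <;> rcases h3 with rfl | rfl | rfl | rfl | rfl | rfl <;> omega

/-- the integer system of order 55, case `(58, 8, 3)`, is infeasible -/
lemma order55_arith58 (a b : ℕ) (k₁ k₃ : ℤ) (ha : a ≤ 3) (hb : b ≤ 5)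
    (hk₁ : (3:ℤ) - 2 * (a:ℤ) + ((5:ℤ) - 2 * (b:ℤ)) = 11 * k₁)
    (hk₃ : (5:ℤ) - 2 * (b:ℤ) = 5 * k₃) : False := by
  have h3 : b = 0 ∨ b = 5 := by clear hk₁ ha; omega
  have h1 : a + b = 4 := by clear hk₃ h3; omega
  omega

section crtB
variable {H : Matrix ι ι ℤ}

/-- the common core: two rows fixed by both parts, sums over the column pieces written as `card − 2m` -/
lemma pair_pieces (hH : IsHadamardMatrix H) {π κ : Equiv.Perm ι} {d e : ι → ℤ} (haut : IsSignedAut H π κ d e)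
    {p q : ℕ} (hp : p.Prime) (hq : q.Prime) (hκ : κ ^ (p * q) = 1)
    (hR : 1 < (univ.filter fun i => (π ^ q) i = i ∧ (π ^ p) i = i).card)
    (hcp : 0 < (univ.filter fun j => (κ ^ p) j = j).card) (hcq : 0 < (univ.filter fun j => (κ ^ q) j = j).card) :
    ∃ (mA mX mY : ℕ) (k₁ k₂ k₃ k₄ : ℤ),
      mA ≤ (univ.filter fun j => (κ ^ q) j = j ∧ (κ ^ p) j = j).card ∧
      mX ≤ (univ.filter fun j => (κ ^ p) j = j ∧ (κ ^ q) j ≠ j).card ∧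
      mY ≤ (univ.filter fun j => (κ ^ q) j = j ∧ (κ ^ p) j ≠ j).card ∧
      ((univ.filter fun j => (κ ^ q) j = j ∧ (κ ^ p) j = j).card : ℤ) - 2 * mA +
        (((univ.filter fun j => (κ ^ p) j = j ∧ (κ ^ q) j ≠ j).card : ℤ) - 2 * mX) = q * k₁ ∧
      ((univ.filter fun j => (κ ^ q) j = j ∧ (κ ^ p) j = j).card : ℤ) - 2 * mA +
        (((univ.filter fun j => (κ ^ q) j = j ∧ (κ ^ p) j ≠ j).card : ℤ) - 2 * mY) = p * k₂ ∧
      ((univ.filter fun j => (κ ^ p) j = j ∧ (κ ^ q) j ≠ j).card : ℤ) - 2 * mX = p * k₃ ∧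
      ((univ.filter fun j => (κ ^ q) j = j ∧ (κ ^ p) j ≠ j).card : ℤ) - 2 * mY = q * k₄ := by
  obtain ⟨x, hx, x', hx', hxx'⟩ := Finset.one_lt_card.mp hR
  simp only [Finset.mem_filter, Finset.mem_univ, true_and] at hx hx'
  obtain ⟨jp, hjp⟩ := Finset.card_pos.mp hcp
  obtain ⟨jq, hjq⟩ := Finset.card_pos.mp hcq
  simp only [Finset.mem_filter, Finset.mem_univ, true_and] at hjp hjq
  obtain ⟨dq, dp, dp', dq'⟩ := composite_pair_dvd hH haut hp hq hκ hxx' hx.2 hx.1 hx'.2 hx'.1 ⟨jp, hjp⟩ ⟨jq, hjq⟩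
  -- dq : q ∣ Σ_{Fix κ^p} ; dp : p ∣ Σ_{Fix κ^q} ; dp' : p ∣ Σ_{κ^p = ∧ κ^q ≠} ; dq' : q ∣ Σ_{κ^q = ∧ κ^p ≠}
  have hsetA : (univ.filter fun j => (κ ^ p) j = j ∧ (κ ^ q) j = j) =
      univ.filter fun j => (κ ^ q) j = j ∧ (κ ^ p) j = j := by
    ext j; simp only [Finset.mem_filter, Finset.mem_univ, true_and]; exact And.comm
  rw [sum_fixed_split (κ ^ p) (κ ^ q), hsetA] at dq
  rw [sum_fixed_split (κ ^ q) (κ ^ p)] at dp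
  have hpm : ∀ (S : Finset ι), ∀ y ∈ S, H x y * H x' y = 1 ∨ H x y * H x' y = -1 := fun S y _ => by
    rcases hH.1 x y with h1 | h1 <;> rcases hH.1 x' y with h2 | h2 <;> simp [h1, h2]
  obtain ⟨mA, hmA, hA⟩ := sum_pm_eq_card_sub_two_mul (univ.filter fun j => (κ ^ q) j = j ∧ (κ ^ p) j = j) _ (hpm _)
  obtain ⟨mX, hmX, hX⟩ := sum_pm_eq_card_sub_two_mul (univ.filter fun j => (κ ^ p) j = j ∧ (κ ^ q) j ≠ j) _ (hpm _)
  obtain ⟨mY, hmY, hY⟩ := sum_pm_eq_card_sub_two_mul (univ.filter fun j => (κ ^ q) j = j ∧ (κ ^ p) j ≠ j) _ (hpm _)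
  rw [hA, hX] at dq
  rw [hA, hY] at dp
  rw [hX] at dp'
  rw [hY] at dq'
  obtain ⟨k₁, hk₁⟩ := dq
  obtain ⟨k₂, hk₂⟩ := dp
  obtain ⟨k₃, hk₃⟩ := dp'
  obtain ⟨k₄, hk₄⟩ := dq'
  exact ⟨mA, mX, mY, k₁, k₂, k₃, k₄, hmA, hmX, hmY, hk₁, hk₂, hk₃, hk₄⟩

/-- columns, order 69, sharpened: the cases `f₃ = 26` and `f₃ = 32` are impossible -/
lemma order69_cols' (hH : IsHadamardMatrix H) (hι : Fintype.card ι = 668)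
    {π κ : Equiv.Perm ι} {d e : ι → ℤ} (haut : IsSignedAut H π κ d e)
    (hπ : π ^ (3 * 23) = 1) (hκ : κ ^ (3 * 23) = 1) (h23 : π ^ 23 ≠ 1 ∨ κ ^ 23 ≠ 1) (h3 : π ^ 3 ≠ 1 ∨ κ ^ 3 ≠ 1) :
    ((univ.filter fun j => (κ ^ 23) j = j).card = 92 ∧ (univ.filter fun j => (κ ^ 3) j = j).card = 24 ∧
        (univ.filter fun j => (κ ^ 23) j = j ∧ (κ ^ 3) j = j).card = 0) ∨
    ((univ.filter fun j => (κ ^ 23) j = j).card = 98 ∧ (univ.filter fun j => (κ ^ 3) j = j).card = 24 ∧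
        (univ.filter fun j => (κ ^ 23) j = j ∧ (κ ^ 3) j = j).card = 6) ∨
    ((univ.filter fun j => (κ ^ 23) j = j).card = 116 ∧ (univ.filter fun j => (κ ^ 3) j = j).card = 1 ∧
        (univ.filter fun j => (κ ^ 23) j = j ∧ (κ ^ 3) j = j).card = 1) ∨
    ((univ.filter fun j => (κ ^ 23) j = j).card = 164 ∧ (univ.filter fun j => (κ ^ 3) j = j).card = 24 ∧
        (univ.filter fun j => (κ ^ 23) j = j ∧ (κ ^ 3) j = j).card = 3) := by
  have hcard : (Fintype.card ι : ℤ) ≠ 0 := by rw [hι]; norm_num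
  have hC := order69_cols hH hι haut hπ hκ h23 h3
  have hR := order69_cols (isHadamard_transpose hH hcard) hι (isSignedAut_transpose haut) hκ hπ h23.symm h3.symm
  -- the 3-parts fix as many rows as columns
  have hπ23 : (π ^ 23) ^ (3 * 3) = 1 := by
    rw [← pow_mul, show 23 * (3 * 3) = 3 * 23 * 3 by norm_num, pow_mul, hπ, one_pow]
  have hκ23 : (κ ^ 23) ^ (3 * 3) = 1 := by
    rw [← pow_mul, show 23 * (3 * 3) = 3 * 23 * 3 by norm_num, pow_mul, hκ, one_pow]
  have hR3 : ¬ 3 ∣ (univ.filter fun i => (π ^ 23) i = i).card := by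
    rcases hR with ⟨h, -⟩ | ⟨h, -⟩ | ⟨h, -⟩ | ⟨h, -⟩ | ⟨h, -⟩ | ⟨h, -⟩ <;> omega
  have hC3 : ¬ 3 ∣ (univ.filter fun j => (κ ^ 23) j = j).card := by
    rcases hC with ⟨h, -⟩ | ⟨h, -⟩ | ⟨h, -⟩ | ⟨h, -⟩ | ⟨h, -⟩ | ⟨h, -⟩ <;> omega
  obtain ⟨heq, -⟩ := signedAut_card_fixed_eq hH (isSignedAut_pow haut 23) (by norm_num : (3 : ℕ).Prime)
    hπ23 hκ23 hR3 hC3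
  -- cardinalities of the column pieces
  obtain ⟨c1, -, c2, -, -, -⟩ := counting_cols κ (by norm_num : (3 : ℕ).Prime) (by norm_num : (23 : ℕ).Prime) hκ
  have hsetX : (univ.filter fun j => (κ ^ 3) j = j ∧ (κ ^ 23) j ≠ j) =
      univ.filter fun j => (κ ^ 23) j ≠ j ∧ (κ ^ 3) j = j := by
    ext j; simp only [Finset.mem_filter, Finset.mem_univ, true_and]; exact And.comm
  have hsetY : (univ.filter fun j => (κ ^ 23) j = j ∧ (κ ^ 3) j ≠ j) =
      univ.filter fun j => (κ ^ 3) j ≠ j ∧ (κ ^ 23) j = j := by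
    ext j; simp only [Finset.mem_filter, Finset.mem_univ, true_and]; exact And.comm
  rcases hC with ⟨hC1, hC2, hC3'⟩ | ⟨hC1, hC2, hC3'⟩ | hC' | hC' | hC' | hC'
  · -- case (26, 24, 3): rows in the same case
    exfalso
    have hR' : (univ.filter fun i => (π ^ 23) i = i ∧ (π ^ 3) i = i).card = 3 := by
      rcases hR with ⟨h1, -, h3⟩ | ⟨h1, -, -⟩ | ⟨h1, -, -⟩ | ⟨h1, -, -⟩ | ⟨h1, -, -⟩ | ⟨h1, -, -⟩ <;> omega
    have hcardX : (univ.filter fun j => (κ ^ 3) j = j ∧ (κ ^ 23) j ≠ j).card = 21 := by rw [hsetX]; omega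
    have hcardY : (univ.filter fun j => (κ ^ 23) j = j ∧ (κ ^ 3) j ≠ j).card = 23 := by rw [hsetY]; omega
    obtain ⟨mA, mX, mY, k₁, k₂, k₃, k₄, hmA, hmX, hmY, hk₁, hk₂, hk₃, hk₄⟩ :=
      pair_pieces hH haut (by norm_num : (3 : ℕ).Prime) (by norm_num : (23 : ℕ).Prime) hκ (by rw [hR']; norm_num)
        (by rw [hC2]; norm_num) (by rw [hC1]; norm_num)
    rw [hC3'] at hmA hk₁ hk₂
    rw [hcardX] at hmX hk₁ hk₃
    rw [hcardY] at hmY hk₂ hk₄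
    push_cast at hk₁ hk₂ hk₃ hk₄
    exact order69_arith26 mA mX mY k₁ k₂ k₃ k₄ hmA hmX hmY (by linarith) (by linarith) (by linarith) (by linarith)
  · -- case (32, 24, 9)
    exfalso
    have hR' : (univ.filter fun i => (π ^ 23) i = i ∧ (π ^ 3) i = i).card = 9 := by
      rcases hR with ⟨h1, -, -⟩ | ⟨h1, -, h3⟩ | ⟨h1, -, -⟩ | ⟨h1, -, -⟩ | ⟨h1, -, -⟩ | ⟨h1, -, -⟩ <;> omega
    have hcardX : (univ.filter fun j => (κ ^ 3) j = j ∧ (κ ^ 23) j ≠ j).card = 15 := by rw [hsetX]; omega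
    have hcardY : (univ.filter fun j => (κ ^ 23) j = j ∧ (κ ^ 3) j ≠ j).card = 23 := by rw [hsetY]; omega
    obtain ⟨mA, mX, mY, k₁, k₂, k₃, k₄, hmA, hmX, hmY, hk₁, hk₂, hk₃, hk₄⟩ :=
      pair_pieces hH haut (by norm_num : (3 : ℕ).Prime) (by norm_num : (23 : ℕ).Prime) hκ (by rw [hR']; norm_num)
        (by rw [hC2]; norm_num) (by rw [hC1]; norm_num)
    rw [hC3'] at hmA hk₁ hk₂
    rw [hcardX] at hmX hk₁ hk₃
    rw [hcardY] at hmY hk₂ hk₄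
    push_cast at hk₁ hk₂ hk₃ hk₄
    exact order69_arith32 mA mX mY k₁ k₂ k₃ k₄ hmA hmX hmY (by linarith) (by linarith) (by linarith) (by linarith)
  · exact Or.inl hC'
  · exact Or.inr (Or.inl hC')
  · exact Or.inr (Or.inr (Or.inl hC'))
  · exact Or.inr (Or.inr (Or.inr hC'))

/-- **order 69 = 3·23, sharpened**: `(f₃, f₂₃, f') ∈ {(92,24,0), (98,24,6), (116,1,1), (164,24,3)}` on columns and on
rows.  Structure only. -/
theorem hadamard668_order69_structure' (hH : IsHadamardMatrix H) (hι : Fintype.card ι = 668)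
    (π κ : Equiv.Perm ι) (d e : ι → ℤ) (haut : IsSignedAut H π κ d e)
    (hπ : π ^ (3 * 23) = 1) (hκ : κ ^ (3 * 23) = 1) (h23 : π ^ 23 ≠ 1 ∨ κ ^ 23 ≠ 1) (h3 : π ^ 3 ≠ 1 ∨ κ ^ 3 ≠ 1) :
    (((univ.filter fun j => (κ ^ 23) j = j).card = 92 ∧ (univ.filter fun j => (κ ^ 3) j = j).card = 24 ∧
        (univ.filter fun j => (κ ^ 23) j = j ∧ (κ ^ 3) j = j).card = 0) ∨
     ((univ.filter fun j => (κ ^ 23) j = j).card = 98 ∧ (univ.filter fun j => (κ ^ 3) j = j).card = 24 ∧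
        (univ.filter fun j => (κ ^ 23) j = j ∧ (κ ^ 3) j = j).card = 6) ∨
     ((univ.filter fun j => (κ ^ 23) j = j).card = 116 ∧ (univ.filter fun j => (κ ^ 3) j = j).card = 1 ∧
        (univ.filter fun j => (κ ^ 23) j = j ∧ (κ ^ 3) j = j).card = 1) ∨
     ((univ.filter fun j => (κ ^ 23) j = j).card = 164 ∧ (univ.filter fun j => (κ ^ 3) j = j).card = 24 ∧
        (univ.filter fun j => (κ ^ 23) j = j ∧ (κ ^ 3) j = j).card = 3)) ∧
    (((univ.filter fun i => (π ^ 23) i = i).card = 92 ∧ (univ.filter fun i => (π ^ 3) i = i).card = 24 ∧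
        (univ.filter fun i => (π ^ 23) i = i ∧ (π ^ 3) i = i).card = 0) ∨
     ((univ.filter fun i => (π ^ 23) i = i).card = 98 ∧ (univ.filter fun i => (π ^ 3) i = i).card = 24 ∧
        (univ.filter fun i => (π ^ 23) i = i ∧ (π ^ 3) i = i).card = 6) ∨
     ((univ.filter fun i => (π ^ 23) i = i).card = 116 ∧ (univ.filter fun i => (π ^ 3) i = i).card = 1 ∧
        (univ.filter fun i => (π ^ 23) i = i ∧ (π ^ 3) i = i).card = 1) ∨
     ((univ.filter fun i => (π ^ 23) i = i).card = 164 ∧ (univ.filter fun i => (π ^ 3) i = i).card = 24 ∧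
        (univ.filter fun i => (π ^ 23) i = i ∧ (π ^ 3) i = i).card = 3)) := by
  have hcard : (Fintype.card ι : ℤ) ≠ 0 := by rw [hι]; norm_num
  exact ⟨order69_cols' hH hι haut hπ hκ h23 h3,
    order69_cols' (isHadamard_transpose hH hcard) hι (isSignedAut_transpose haut) hκ hπ h23.symm h3.symm⟩

/-- columns, order 55, sharpened: the case `f₅ = 58` is impossible -/
lemma order55_cols' (hH : IsHadamardMatrix H) (hι : Fintype.card ι = 668)
    {π κ : Equiv.Perm ι} {d e : ι → ℤ} (haut : IsSignedAut H π κ d e)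
    (hπ : π ^ (5 * 11) = 1) (hκ : κ ^ (5 * 11) = 1) (h11 : π ^ 11 ≠ 1 ∨ κ ^ 11 ≠ 1) (h5 : π ^ 5 ≠ 1 ∨ κ ^ 5 ≠ 1) :
    ((univ.filter fun j => (κ ^ 11) j = j).card = 8 ∧ (univ.filter fun j => (κ ^ 5) j = j).card = 8 ∧
        (univ.filter fun j => (κ ^ 11) j = j ∧ (κ ^ 5) j = j).card = 8) ∨
    ((univ.filter fun j => (κ ^ 11) j = j).card = 18 ∧ (univ.filter fun j => (κ ^ 5) j = j).card = 52 ∧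
        (univ.filter fun j => (κ ^ 11) j = j ∧ (κ ^ 5) j = j).card = 7) ∨
    ((univ.filter fun j => (κ ^ 11) j = j).card = 38 ∧ (univ.filter fun j => (κ ^ 5) j = j).card = 30 ∧
        (univ.filter fun j => (κ ^ 11) j = j ∧ (κ ^ 5) j = j).card = 5) ∨
    ((univ.filter fun j => (κ ^ 11) j = j).card = 68 ∧ (univ.filter fun j => (κ ^ 5) j = j).card = 52 ∧
        (univ.filter fun j => (κ ^ 11) j = j ∧ (κ ^ 5) j = j).card = 2) ∨
    ((univ.filter fun j => (κ ^ 11) j = j).card = 78 ∧ (univ.filter fun j => (κ ^ 5) j = j).card = 52 ∧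
        (univ.filter fun j => (κ ^ 11) j = j ∧ (κ ^ 5) j = j).card = 12) ∨
    ((univ.filter fun j => (κ ^ 11) j = j).card = 88 ∧ (univ.filter fun j => (κ ^ 5) j = j).card = 30 ∧
        (univ.filter fun j => (κ ^ 11) j = j ∧ (κ ^ 5) j = j).card = 0) ∨
    ((univ.filter fun j => (κ ^ 11) j = j).card = 98 ∧ (univ.filter fun j => (κ ^ 5) j = j).card = 30 ∧
        (univ.filter fun j => (κ ^ 11) j = j ∧ (κ ^ 5) j = j).card = 10) := by
  have hcard : (Fintype.card ι : ℤ) ≠ 0 := by rw [hι]; norm_num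
  have hC := order55_cols hH hι haut hπ hκ h11 h5
  have hR := order55_cols (isHadamard_transpose hH hcard) hι (isSignedAut_transpose haut) hκ hπ h11.symm h5.symm
  -- the 5-parts fix as many rows as columns
  have hπ11 : (π ^ 11) ^ (5 * 5) = 1 := by
    rw [← pow_mul, show 11 * (5 * 5) = 5 * 11 * 5 by norm_num, pow_mul, hπ, one_pow]
  have hκ11 : (κ ^ 11) ^ (5 * 5) = 1 := by
    rw [← pow_mul, show 11 * (5 * 5) = 5 * 11 * 5 by norm_num, pow_mul, hκ, one_pow]
  have hR5 : ¬ 5 ∣ (univ.filter fun i => (π ^ 11) i = i).card := by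
    rcases hR with ⟨h, -⟩ | ⟨h, -⟩ | ⟨h, -⟩ | ⟨h, -⟩ | ⟨h, -⟩ | ⟨h, -⟩ | ⟨h, -⟩ | ⟨h, -⟩ <;> omega
  have hC5 : ¬ 5 ∣ (univ.filter fun j => (κ ^ 11) j = j).card := by
    rcases hC with ⟨h, -⟩ | ⟨h, -⟩ | ⟨h, -⟩ | ⟨h, -⟩ | ⟨h, -⟩ | ⟨h, -⟩ | ⟨h, -⟩ | ⟨h, -⟩ <;> omega
  obtain ⟨heq, -⟩ := signedAut_card_fixed_eq hH (isSignedAut_pow haut 11) (by norm_num : (5 : ℕ).Prime)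
    hπ11 hκ11 hR5 hC5
  obtain ⟨c1, -, c2, -, -, -⟩ := counting_cols κ (by norm_num : (5 : ℕ).Prime) (by norm_num : (11 : ℕ).Prime) hκ
  have hsetX : (univ.filter fun j => (κ ^ 5) j = j ∧ (κ ^ 11) j ≠ j) =
      univ.filter fun j => (κ ^ 11) j ≠ j ∧ (κ ^ 5) j = j := by
    ext j; simp only [Finset.mem_filter, Finset.mem_univ, true_and]; exact And.comm
  rcases hC with hC' | hC' | hC' | ⟨hC1, hC2, hC3'⟩ | hC' | hC' | hC' | hC'
  · exact Or.inl hC'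
  · exact Or.inr (Or.inl hC')
  · exact Or.inr (Or.inr (Or.inl hC'))
  · -- case (58, 8, 3)
    exfalso
    have hR' : (univ.filter fun i => (π ^ 11) i = i ∧ (π ^ 5) i = i).card = 3 := by
      rcases hR with ⟨h1, -, -⟩ | ⟨h1, -, -⟩ | ⟨h1, -, -⟩ | ⟨h1, -, h3⟩ | ⟨h1, -, -⟩ | ⟨h1, -, -⟩ | ⟨h1, -, -⟩ |
        ⟨h1, -, -⟩ <;> omega
    have hcardX : (univ.filter fun j => (κ ^ 5) j = j ∧ (κ ^ 11) j ≠ j).card = 5 := by rw [hsetX]; omega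
    obtain ⟨mA, mX, mY, k₁, k₂, k₃, k₄, hmA, hmX, -, hk₁, -, hk₃, -⟩ :=
      pair_pieces hH haut (by norm_num : (5 : ℕ).Prime) (by norm_num : (11 : ℕ).Prime) hκ (by rw [hR']; norm_num)
        (by rw [hC2]; norm_num) (by rw [hC1]; norm_num)
    rw [hC3'] at hmA hk₁
    rw [hcardX] at hmX hk₁ hk₃
    push_cast at hk₁ hk₃
    exact order55_arith58 mA mX k₁ k₃ hmA hmX (by linarith) (by linarith)
  · exact Or.inr (Or.inr (Or.inr (Or.inl hC')))
  · exact Or.inr (Or.inr (Or.inr (Or.inr (Or.inl hC'))))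
  · exact Or.inr (Or.inr (Or.inr (Or.inr (Or.inr (Or.inl hC')))))
  · exact Or.inr (Or.inr (Or.inr (Or.inr (Or.inr (Or.inr hC')))))

/-- **order 55 = 5·11, sharpened**: `(f₅, f₁₁, f')` lies in the seven-element list of `order55_cols'`, on columns and on
rows.  Structure only. -/
theorem hadamard668_order55_structure' (hH : IsHadamardMatrix H) (hι : Fintype.card ι = 668)
    (π κ : Equiv.Perm ι) (d e : ι → ℤ) (haut : IsSignedAut H π κ d e)
    (hπ : π ^ (5 * 11) = 1) (hκ : κ ^ (5 * 11) = 1) (h11 : π ^ 11 ≠ 1 ∨ κ ^ 11 ≠ 1) (h5 : π ^ 5 ≠ 1 ∨ κ ^ 5 ≠ 1) :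
    (((univ.filter fun j => (κ ^ 11) j = j).card = 8 ∧ (univ.filter fun j => (κ ^ 5) j = j).card = 8 ∧
        (univ.filter fun j => (κ ^ 11) j = j ∧ (κ ^ 5) j = j).card = 8) ∨
     ((univ.filter fun j => (κ ^ 11) j = j).card = 18 ∧ (univ.filter fun j => (κ ^ 5) j = j).card = 52 ∧
        (univ.filter fun j => (κ ^ 11) j = j ∧ (κ ^ 5) j = j).card = 7) ∨
     ((univ.filter fun j => (κ ^ 11) j = j).card = 38 ∧ (univ.filter fun j => (κ ^ 5) j = j).card = 30 ∧
        (univ.filter fun j => (κ ^ 11) j = j ∧ (κ ^ 5) j = j).card = 5) ∨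
     ((univ.filter fun j => (κ ^ 11) j = j).card = 68 ∧ (univ.filter fun j => (κ ^ 5) j = j).card = 52 ∧
        (univ.filter fun j => (κ ^ 11) j = j ∧ (κ ^ 5) j = j).card = 2) ∨
     ((univ.filter fun j => (κ ^ 11) j = j).card = 78 ∧ (univ.filter fun j => (κ ^ 5) j = j).card = 52 ∧
        (univ.filter fun j => (κ ^ 11) j = j ∧ (κ ^ 5) j = j).card = 12) ∨
     ((univ.filter fun j => (κ ^ 11) j = j).card = 88 ∧ (univ.filter fun j => (κ ^ 5) j = j).card = 30 ∧
        (univ.filter fun j => (κ ^ 11) j = j ∧ (κ ^ 5) j = j).card = 0) ∨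
     ((univ.filter fun j => (κ ^ 11) j = j).card = 98 ∧ (univ.filter fun j => (κ ^ 5) j = j).card = 30 ∧
        (univ.filter fun j => (κ ^ 11) j = j ∧ (κ ^ 5) j = j).card = 10)) ∧
    (((univ.filter fun i => (π ^ 11) i = i).card = 8 ∧ (univ.filter fun i => (π ^ 5) i = i).card = 8 ∧
        (univ.filter fun i => (π ^ 11) i = i ∧ (π ^ 5) i = i).card = 8) ∨
     ((univ.filter fun i => (π ^ 11) i = i).card = 18 ∧ (univ.filter fun i => (π ^ 5) i = i).card = 52 ∧
        (univ.filter fun i => (π ^ 11) i = i ∧ (π ^ 5) i = i).card = 7) ∨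
     ((univ.filter fun i => (π ^ 11) i = i).card = 38 ∧ (univ.filter fun i => (π ^ 5) i = i).card = 30 ∧
        (univ.filter fun i => (π ^ 11) i = i ∧ (π ^ 5) i = i).card = 5) ∨
     ((univ.filter fun i => (π ^ 11) i = i).card = 68 ∧ (univ.filter fun i => (π ^ 5) i = i).card = 52 ∧
        (univ.filter fun i => (π ^ 11) i = i ∧ (π ^ 5) i = i).card = 2) ∨
     ((univ.filter fun i => (π ^ 11) i = i).card = 78 ∧ (univ.filter fun i => (π ^ 5) i = i).card = 52 ∧
        (univ.filter fun i => (π ^ 11) i = i ∧ (π ^ 5) i = i).card = 12) ∨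
     ((univ.filter fun i => (π ^ 11) i = i).card = 88 ∧ (univ.filter fun i => (π ^ 5) i = i).card = 30 ∧
        (univ.filter fun i => (π ^ 11) i = i ∧ (π ^ 5) i = i).card = 0) ∨
     ((univ.filter fun i => (π ^ 11) i = i).card = 98 ∧ (univ.filter fun i => (π ^ 5) i = i).card = 30 ∧
        (univ.filter fun i => (π ^ 11) i = i ∧ (π ^ 5) i = i).card = 10)) := by
  have hcard : (Fintype.card ι : ℤ) ≠ 0 := by rw [hι]; norm_num
  exact ⟨order55_cols' hH hι haut hπ hκ h11 h5,
    order55_cols' (isHadamard_transpose hH hcard) hι (isSignedAut_transpose haut) hκ hπ h11.symm h5.symm⟩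

end crtB

end Summit.Ventures.DiscreteObjects.Hadamard
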